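import Literature.Analysis.FluidPDE.PineauVicolOneSlicePressure
import Literature.Analysis.PDE.NewtonianKernel

/-!
# QuietScarPocketDoorZoomEnergies — door S31 «QuietScarPocketDoor» (nsreg-p1 g25 ROUND-29 v2.1, texts `r29/Sketch31.lean`
# 363b5766493b6c28; Defs p622283), K-piece PK1 `scarPocketZoom_holds`, file F1: SCALE-INVARIANT ALBRITTON–BARKER
# QUANTITIES FOR THE PINEAU–VICOL CLASS ON ALL SUB-CYLINDERS

PK1 (class zoom at the pocket scale, LEAD ns-s30-p1; skeleton `HOME/ns-s30-p1/PK1-Skeleton.lean`) feeds the tree's class-zoom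
engine `LocalTypeIBlowup.exists_typeIAncientMild_zoomLimit_seq`, which wants a UNIFORM bound on Albritton–Barker's quantity
`𝐈 = sup_{Q(z,r)} (A + C + D + E)` over ALL parabolic sub-cylinders of a fixed apex cylinder.  This file gives the cubic quantity:

* `exists_pv_cknC_le` (F1a): `C(r;z) = r⁻² ∫∫_{Q(z,r)} |u|³ ≤ K · C_u³` for EVERY `Q(z,r) ⊆ Q(0,1)`, for every field with the
  one-point Type-I bound `|u(t,x)| ≤ C_u/(√(−t) + |x|)` on `[−1,0) × B₁` — scale-exactly: `|u|³ ≤ C_u³ (−t)^{−1/4}|x|^{−5/2}`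
  (`norm_cube_le_of_typeI`), `(−t)^{−1/4} ≤ (z.1 − t)^{−1/4}` (`z.1 ≤ 0`), `∫_{z.1−r²}^{z.1} (z.1−t)^{−1/4} dt = (4/3) r^{3/2}`
  and `∫_{B(x₀,r)} |x|^{−5/2} dx ≤ 7|B₁| r^{1/2}` for ANY centre (`Newtonian.setIntegral_ball_norm_sub_rpow_neg_le`).

Door S31 is a regularity CRITERION about a HYPOTHETICAL one-point Type-I blow-up; item 0056 `NoTypeII` and NS regularity are
NOT proved and stay OPEN.
-/

noncomputable section

set_option linter.dupNamespace false

namespace Summit.NavierStokesRegularity.NavierStokesRegularity.Theorems.QuietScarPocketDoor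

open MeasureTheory Set Function Filter Topology TopologicalSpace Metric
open scoped NNReal ENNReal Topology
open Literature.Analysis Literature.Analysis.FluidPDE

/-- the time factor of the cubic majorant on a cylinder with top time `z₁`: `∫_{z₁−r²}^{z₁} (z₁ − t)^{−1/4} dt = (4/3) r^{3/2}`. -/
theorem lintegral_Ioo_rpow_neg_quarter_sub (z₁ : ℝ) {r : ℝ} (hr : 0 < r) :
    ∫⁻ t in Ioo (z₁ - r ^ 2) z₁, ENNReal.ofReal ((z₁ - t) ^ (-(1 / 4 : ℝ))) =
      ENNReal.ofReal (4 / 3 * r ^ (3 / 2 : ℝ)) := by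
  have hr2 : 0 < r ^ 2 := by positivity
  have hii : IntervalIntegrable (fun σ : ℝ => σ ^ (-(1 / 4 : ℝ))) volume 0 (r ^ 2) :=
    intervalIntegral.intervalIntegrable_rpow' (by norm_num)
  have hii' : IntervalIntegrable (fun t : ℝ => (z₁ - t) ^ (-(1 / 4 : ℝ))) volume (z₁ - r ^ 2) z₁ := by
    have h := (hii.comp_sub_left z₁).symm
    simpa only [sub_zero] using h
  have hint : IntegrableOn (fun t : ℝ => (z₁ - t) ^ (-(1 / 4 : ℝ))) (Ioo (z₁ - r ^ 2) z₁) volume :=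
    (intervalIntegrable_iff_integrableOn_Ioo_of_le (by linarith)).1 hii'
  have hnn : 0 ≤ᵐ[volume.restrict (Ioo (z₁ - r ^ 2) z₁)] fun t : ℝ => (z₁ - t) ^ (-(1 / 4 : ℝ)) :=
    (ae_restrict_iff' measurableSet_Ioo).2 (ae_of_all _ fun t ht => Real.rpow_nonneg (by linarith [ht.2]) _)
  rw [← ofReal_integral_eq_lintegral_ofReal hint hnn]
  congr 1
  rw [← integral_Ioc_eq_integral_Ioo, ← intervalIntegral.integral_of_le (by linarith),
    intervalIntegral.integral_comp_sub_left (fun σ : ℝ => σ ^ (-(1 / 4 : ℝ))) z₁]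
  simp only [sub_self, sub_sub_cancel]
  rw [integral_rpow (Or.inl (by norm_num)), Real.zero_rpow (by norm_num), sub_zero]
  have h34 : (r ^ 2) ^ (-(1 / 4 : ℝ) + 1) = r ^ (3 / 2 : ℝ) := by
    rw [show (-(1 / 4 : ℝ) + 1) = 3 / 4 by norm_num, show r ^ 2 = r ^ (2 : ℝ) by norm_cast,
      ← Real.rpow_mul hr.le]
    norm_num
  rw [h34]
  ring

/-- the space factor, for a ball with ANY centre: `∫_{B(c,r)} |x|^{−5/2} dx ≤ 7 |B₁| r^{1/2}` in `ℝ³`. -/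
theorem lintegral_ball_norm_rpow_neg_le (c : EuclideanSpace ℝ (Fin 3)) {r : ℝ} (hr : 0 < r) :
    ∫⁻ x in ball c r, ENNReal.ofReal (‖x‖ ^ (-(5 / 2 : ℝ))) ≤
      ENNReal.ofReal (7 * volume.real (ball (0 : EuclideanSpace ℝ (Fin 3)) 1) * r ^ (1 / 2 : ℝ)) := by
  have hn : 3 ≤ Module.finrank ℝ (EuclideanSpace ℝ (Fin 3)) := by rw [finrank_euclideanSpace_fin]
  have hs : (5 / 2 : ℝ) < Module.finrank ℝ (EuclideanSpace ℝ (Fin 3)) := by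
    rw [finrank_euclideanSpace_fin]; norm_num
  -- integrability on the bigger ball centred at the origin, restricted to `B(c,r)`
  have hsub : ball c r ⊆ ball (0 : EuclideanSpace ℝ (Fin 3)) (‖c‖ + r) := by
    intro x hx
    rw [mem_ball, dist_zero_right]
    rw [mem_ball, dist_eq_norm] at hx
    calc ‖x‖ = ‖(x - c) + c‖ := by rw [sub_add_cancel]
      _ ≤ ‖x - c‖ + ‖c‖ := norm_add_le _ _
      _ < ‖c‖ + r := by linarith
  have hint0 := (Literature.Analysis.PDE.Newtonian.integrableOn_ball_norm_sub_rpow_neg hn hs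
    (0 : EuclideanSpace ℝ (Fin 3)) (‖c‖ + r)).1
  have hint : IntegrableOn (fun x : EuclideanSpace ℝ (Fin 3) => ‖(0 : EuclideanSpace ℝ (Fin 3)) - x‖ ^ (-(5 / 2 : ℝ)))
      (ball c r) volume := hint0.mono_set hsub
  have hle := Literature.Analysis.PDE.Newtonian.setIntegral_ball_norm_sub_rpow_neg_le hn
    (by norm_num : (0 : ℝ) ≤ 5 / 2) hs c (0 : EuclideanSpace ℝ (Fin 3)) hr
  rw [finrank_euclideanSpace_fin] at hle
  have h7 : ((((3 : ℕ) : ℝ)) / (((3 : ℕ) : ℝ) - 5 / 2) + 1) = 7 := by norm_num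
  have h12 : (((3 : ℕ) : ℝ) - 5 / 2) = 1 / 2 := by norm_num
  rw [h7, h12] at hle
  have hnn : 0 ≤ᵐ[volume.restrict (ball c r)]
      fun x : EuclideanSpace ℝ (Fin 3) => ‖(0 : EuclideanSpace ℝ (Fin 3)) - x‖ ^ (-(5 / 2 : ℝ)) :=
    ae_of_all _ fun x => Real.rpow_nonneg (norm_nonneg _) _
  calc ∫⁻ x in ball c r, ENNReal.ofReal (‖x‖ ^ (-(5 / 2 : ℝ)))
      = ∫⁻ x in ball c r, ENNReal.ofReal (‖(0 : EuclideanSpace ℝ (Fin 3)) - x‖ ^ (-(5 / 2 : ℝ))) := by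
        simp only [zero_sub, norm_neg]
    _ = ENNReal.ofReal (∫ x in ball c r, ‖(0 : EuclideanSpace ℝ (Fin 3)) - x‖ ^ (-(5 / 2 : ℝ))) :=
        (ofReal_integral_eq_lintegral_ofReal hint hnn).symm
    _ ≤ ENNReal.ofReal (7 * volume.real (ball (0 : EuclideanSpace ℝ (Fin 3)) 1) * r ^ (1 / 2 : ℝ)) :=
        ENNReal.ofReal_le_ofReal hle

/-- the sign of the class constant: the one-point bound at `(t,x) = (−1/2, 0)` forces `0 ≤ C_u`. -/
theorem pv_typeI_const_nonneg {u : ℝ → EuclideanSpace ℝ (Fin 3) → EuclideanSpace ℝ (Fin 3)} {Cu : ℝ}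
    (hI : ∀ t ∈ Ico (-1 : ℝ) 0, ∀ x ∈ ball (0 : EuclideanSpace ℝ (Fin 3)) 1, ‖u t x‖ ≤ Cu / (Real.sqrt (-t) + ‖x‖)) :
    0 ≤ Cu := by
  have h := hI (-(1 / 2 : ℝ)) ⟨by norm_num, by norm_num⟩ 0 (mem_ball_self one_pos)
  rw [norm_zero, add_zero] at h
  have hs : 0 < Real.sqrt (-(-(1 / 2 : ℝ))) := Real.sqrt_pos.2 (by norm_num)
  have h0 : 0 ≤ Cu / Real.sqrt (-(-(1 / 2 : ℝ))) := (norm_nonneg _).trans h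
  exact (div_nonneg_iff.1 h0).elim (fun h => h.1) fun h => absurd h.2 (not_le.2 hs)

/-- a parabolic sub-cylinder of the unit apex cylinder has its time interval in `(−1,0)` (so its top time is `≤ 0`) and its
ball in `B₁`. -/
theorem pv_subcylinder {r : ℝ} (hr : 0 < r) {z : ℝ × EuclideanSpace ℝ (Fin 3)}
    (hQ : parabolicCylinder r z ⊆ parabolicCylinder 1 (0 : ℝ × EuclideanSpace ℝ (Fin 3))) :
    (-1 : ℝ) ≤ z.1 - r ^ 2 ∧ z.1 ≤ 0 ∧ ball z.2 r ⊆ ball (0 : EuclideanSpace ℝ (Fin 3)) 1 := by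
  have hne1 : (Ioo (z.1 - r ^ 2) z.1).Nonempty := nonempty_Ioo.2 (by nlinarith)
  have hne2 : (ball z.2 r).Nonempty := nonempty_ball.2 hr
  have h := (prod_subset_prod_iff.1 (show Ioo (z.1 - r ^ 2) z.1 ×ˢ ball z.2 r ⊆
    Ioo ((0 : ℝ × EuclideanSpace ℝ (Fin 3)).1 - 1 ^ 2) (0 : ℝ × EuclideanSpace ℝ (Fin 3)).1 ×ˢ
      ball (0 : ℝ × EuclideanSpace ℝ (Fin 3)).2 1 from hQ))
  rcases h with ⟨h1, h2⟩ | h | h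
  · have h1' := (Ioo_subset_Ioo_iff (by nlinarith : z.1 - r ^ 2 < z.1)).1 h1
    simp only [Prod.fst_zero, one_pow, zero_sub] at h1'
    exact ⟨h1'.1, h1'.2, by simpa using h2⟩
  · exact absurd h hne1.ne_empty
  · exact absurd h hne2.ne_empty

/-- **F1a — the cubic Albritton–Barker quantity of the Pineau–Vicol class is bounded on EVERY sub-cylinder of the apex
cylinder, scale-invariantly**: `C(r;z) = r⁻² ∫∫_{Q(z,r)} |u|³ ≤ K·C_u³` for all `Q(z,r) ⊆ Q(0,1)`, `K = (28/3)|B₁|`. -/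
theorem exists_pv_cknC_le : ∃ K : ℝ≥0, ∀ (Cu : ℝ) (u : ℝ → EuclideanSpace ℝ (Fin 3) → EuclideanSpace ℝ (Fin 3)),
    (∀ t ∈ Ico (-1 : ℝ) 0, ∀ x ∈ ball (0 : EuclideanSpace ℝ (Fin 3)) 1, ‖u t x‖ ≤ Cu / (Real.sqrt (-t) + ‖x‖)) →
    ∀ (r : ℝ) (z : ℝ × EuclideanSpace ℝ (Fin 3)), 0 < r →
      parabolicCylinder r z ⊆ parabolicCylinder 1 (0 : ℝ × EuclideanSpace ℝ (Fin 3)) →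
      cknC r z u ≤ K * ENNReal.ofReal (Cu ^ 3) := by
  set V : ℝ := volume.real (ball (0 : EuclideanSpace ℝ (Fin 3)) 1) with hV
  have hV0 : 0 ≤ V := measureReal_nonneg
  refine ⟨(28 / 3 * V).toNNReal, fun Cu u hI r z hr hQ => ?_⟩
  have hCu : 0 ≤ Cu := pv_typeI_const_nonneg hI
  obtain ⟨hz1, hz0, hball⟩ := pv_subcylinder hr hQ
  -- a.e. `w.2 ≠ 0`
  have h0 : ∀ᵐ w ∂(volume : Measure (ℝ × EuclideanSpace ℝ (Fin 3))), w.2 ≠ 0 := by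
    rw [ae_iff]
    have hset : {w : ℝ × EuclideanSpace ℝ (Fin 3) | ¬w.2 ≠ 0} =
        (univ : Set ℝ) ×ˢ {(0 : EuclideanSpace ℝ (Fin 3))} := by
      ext w; simp
    rw [hset, Measure.volume_eq_prod, Measure.prod_prod]
    simp
  -- the separated majorant on the cylinder
  have hle : ∀ᵐ w ∂(volume.restrict (parabolicCylinder r z)),
      ‖u w.1 w.2‖ₑ ^ (3 : ℕ) ≤ ENNReal.ofReal (Cu ^ 3) *
        (ENNReal.ofReal ((z.1 - w.1) ^ (-(1 / 4 : ℝ))) * ENNReal.ofReal (‖w.2‖ ^ (-(5 / 2 : ℝ)))) := by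
    filter_upwards [ae_restrict_mem (measurableSet_Ioo.prod measurableSet_ball), ae_restrict_of_ae h0]
      with w hw hw0
    obtain ⟨ht, hx⟩ := mem_prod.1 hw
    have ht' : w.1 ∈ Ico (-1 : ℝ) 0 := ⟨by linarith [ht.1], by linarith [ht.2]⟩
    have h := norm_cube_le_of_typeI hI ht' (hball hx) hw0
    have hneg : 0 < z.1 - w.1 := by linarith [ht.2]
    have hmono : (-w.1) ^ (-(1 / 4 : ℝ)) ≤ (z.1 - w.1) ^ (-(1 / 4 : ℝ)) :=
      Real.rpow_le_rpow_of_nonpos hneg (by linarith) (by norm_num)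
    have h' : ‖u w.1 w.2‖ ^ 3 ≤ Cu ^ 3 * ((z.1 - w.1) ^ (-(1 / 4 : ℝ)) * ‖w.2‖ ^ (-(5 / 2 : ℝ))) :=
      h.trans (mul_le_mul_of_nonneg_left (mul_le_mul_of_nonneg_right hmono
        (Real.rpow_nonneg (norm_nonneg _) _)) (pow_nonneg hCu 3))
    rw [← ENNReal.ofReal_mul (Real.rpow_nonneg hneg.le _), ← ENNReal.ofReal_mul (pow_nonneg hCu 3),
      ← ofReal_norm, ← ENNReal.ofReal_pow (norm_nonneg _)]
    exact ENNReal.ofReal_le_ofReal h'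
  have hmT : Measurable fun t : ℝ => ENNReal.ofReal ((z.1 - t) ^ (-(1 / 4 : ℝ))) :=
    ((measurable_const.sub measurable_id).pow_const _).ennreal_ofReal
  have hmX : Measurable fun x : EuclideanSpace ℝ (Fin 3) => ENNReal.ofReal (‖x‖ ^ (-(5 / 2 : ℝ))) :=
    (continuous_norm.measurable.pow_const _).ennreal_ofReal
  have hint : ∫⁻ w in parabolicCylinder r z, ‖u w.1 w.2‖ₑ ^ (3 : ℕ) ≤
      ENNReal.ofReal (Cu ^ 3) * (ENNReal.ofReal (4 / 3 * r ^ (3 / 2 : ℝ)) *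
        ENNReal.ofReal (7 * V * r ^ (1 / 2 : ℝ))) := by
    calc ∫⁻ w in parabolicCylinder r z, ‖u w.1 w.2‖ₑ ^ (3 : ℕ)
        ≤ ∫⁻ w in parabolicCylinder r z, ENNReal.ofReal (Cu ^ 3) *
            (ENNReal.ofReal ((z.1 - w.1) ^ (-(1 / 4 : ℝ))) * ENNReal.ofReal (‖w.2‖ ^ (-(5 / 2 : ℝ)))) :=
          lintegral_mono_ae hle
      _ = ENNReal.ofReal (Cu ^ 3) * ∫⁻ w in parabolicCylinder r z,
            ENNReal.ofReal ((z.1 - w.1) ^ (-(1 / 4 : ℝ))) * ENNReal.ofReal (‖w.2‖ ^ (-(5 / 2 : ℝ))) := by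
          rw [lintegral_const_mul]
          exact (hmT.comp measurable_fst).mul (hmX.comp measurable_snd)
      _ = ENNReal.ofReal (Cu ^ 3) * ((∫⁻ t in Ioo (z.1 - r ^ 2) z.1, ENNReal.ofReal ((z.1 - t) ^ (-(1 / 4 : ℝ)))) *
            ∫⁻ x in ball z.2 r, ENNReal.ofReal (‖x‖ ^ (-(5 / 2 : ℝ)))) := by
          rw [show parabolicCylinder r z = Ioo (z.1 - r ^ 2) z.1 ×ˢ ball z.2 r from rfl,
            Measure.volume_eq_prod, ← Measure.prod_restrict, lintegral_prod_mul hmT.aemeasurable hmX.aemeasurable]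
      _ ≤ ENNReal.ofReal (Cu ^ 3) * (ENNReal.ofReal (4 / 3 * r ^ (3 / 2 : ℝ)) *
            ENNReal.ofReal (7 * V * r ^ (1 / 2 : ℝ))) := by
          rw [lintegral_Ioo_rpow_neg_quarter_sub z.1 hr]
          gcongr
          exact lintegral_ball_norm_rpow_neg_le z.2 hr
  -- normalise by `r²`
  have hr2 : ENNReal.ofReal (r ^ 2) ≠ 0 := by positivity
  have hprod : ENNReal.ofReal (4 / 3 * r ^ (3 / 2 : ℝ)) * ENNReal.ofReal (7 * V * r ^ (1 / 2 : ℝ)) =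
      ENNReal.ofReal (r ^ 2) * ENNReal.ofReal (28 / 3 * V) := by
    rw [← ENNReal.ofReal_mul (by positivity), ← ENNReal.ofReal_mul (by positivity)]
    congr 1
    have hrr : r ^ (3 / 2 : ℝ) * r ^ (1 / 2 : ℝ) = r ^ 2 := by
      rw [← Real.rpow_add hr, show (3 / 2 : ℝ) + 1 / 2 = 2 by norm_num]; norm_cast
    calc 4 / 3 * r ^ (3 / 2 : ℝ) * (7 * V * r ^ (1 / 2 : ℝ)) = 28 / 3 * V * (r ^ (3 / 2 : ℝ) * r ^ (1 / 2 : ℝ)) := by ring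
      _ = r ^ 2 * (28 / 3 * V) := by rw [hrr]; ring
  have hK : ((28 / 3 * V).toNNReal : ℝ≥0∞) = ENNReal.ofReal (28 / 3 * V) := rfl
  unfold cknC
  rw [← ENNReal.ofReal_pow hr.le, hK]
  calc (ENNReal.ofReal (r ^ 2))⁻¹ * ∫⁻ w in parabolicCylinder r z, ‖u w.1 w.2‖ₑ ^ (3 : ℕ)
      ≤ (ENNReal.ofReal (r ^ 2))⁻¹ * (ENNReal.ofReal (Cu ^ 3) * (ENNReal.ofReal (r ^ 2) * ENNReal.ofReal (28 / 3 * V))) := by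
        rw [← hprod]; gcongr
    _ = ENNReal.ofReal (28 / 3 * V) * ENNReal.ofReal (Cu ^ 3) := by
        rw [show (ENNReal.ofReal (r ^ 2))⁻¹ * (ENNReal.ofReal (Cu ^ 3) * (ENNReal.ofReal (r ^ 2) * ENNReal.ofReal (28 / 3 * V)))
            = ((ENNReal.ofReal (r ^ 2))⁻¹ * ENNReal.ofReal (r ^ 2)) * (ENNReal.ofReal (28 / 3 * V) * ENNReal.ofReal (Cu ^ 3)) by ring,
          ENNReal.inv_mul_cancel hr2 ENNReal.ofReal_ne_top, one_mul]

end Summit.NavierStokesRegularity.NavierStokesRegularity.Theorems.QuietScarPocketDoor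

end
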